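import Literature.Analysis.SpecialFunctions.RiemannThetaLefschetz
import Literature.Analysis.SpecialFunctions.RiemannThetaCharacteristics
import HarnessLib

/-!
# Lefschetz's theorem for complex tori of polarisation type `D`: the level-three theta functions of type `D`

Analytic form, on `ℂ^g`, of **Lefschetz's embedding theorem for the complex torus
`ℂ^g/(Dℤ^g ⊕ Ωℤ^g)`** of an arbitrary polarisation type `D = diag(d₁, …, d_g)` (`dᵢ ≥ 1` integers)
in Siegel normal form (`Ω` symmetric, `Im Ω` positive definite): the `3^g · d₁⋯d_g` **theta
functions of level three and type `D`**

  `G_k(z) = e^{2πi ᵗk D⁻¹ z} ϑ(3z + ΩD⁻¹k, 3Ω)`,  `k ∈ ∏ᵢ {0, 1, …, 3dᵢ - 1}`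

(the classical basis `ϑ[(3D)⁻¹k, 0](3z, 3Ω)` of `H⁰(L³)` for the line bundle `L` of type `D`, up to
the non-zero constants `e^{3πi ᵗa Ω a}`, `a = (3D)⁻¹k`; Lange–Birkenhake, *Complex Abelian Varieties*,
§3.2, Remark 8.5.3 and Thm. 4.5.1; Mumford, *Tata Lectures on Theta I*, Ch. II §1) are entire,
`Dℤ^g`-periodic, carry the COMMON factor of automorphy `exp(-3πi ᵗnΩn - 6πi ᵗn z)` along `Ωℤ^g`,
and

* have **no common zero**,
* **separate points modulo the lattice `Dℤ^g ⊕ Ωℤ^g`**: `G_k(z₂) = γ G_k(z₁)` for all `k` forces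
  `z₂ - z₁ = Dm + Ωn` with `m, n ∈ ℤ^g`,
* **separate tangent vectors**: `∂_v G_k(z) = μ G_k(z)` for all `k` forces `v = 0`,

i.e. `z ↦ [G_k(z)]_k` descends to an injective holomorphic immersion of `ℂ^g/(Dℤ^g ⊕ Ωℤ^g)` into
`ℙ^{3^g d₁⋯d_g - 1}(ℂ)` (Lange–Birkenhake Thm. 4.5.1: `L³` is very ample for every positive `L`).

The principal case `D = 1` is `RiemannThetaLefschetz.lean` (`exists_lefschetz_levelThree_family`).
The general case is REDUCED to it here: for the shifted level-three functions
`G_r(z) = e^{2πi ᵗr z} ϑ(3z + Ωr, 3Ω)` (`r ∈ ℂ^g`; `levelThreeTheta`) one has the elementary identity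
`G_{r+c}(z) = e^{2πi(ᵗr z - ᵗcΩr/3)} · f_c(z + Ωr/3)` (`levelThreeTheta_add_shift`), `f_c = G_c` the
principal family, `c ∈ {0,1,2}^g`. Hence every sub-family `k₀ + Dc` of the type-`D` family is, up to
non-zero factors, the principal family at the translated point `z + ΩD⁻¹k₀/3`; no common zero and
separation of tangents follow from the principal family (`k₀ = 0`), and so does
`z₂ - z₁ = m + Ωn` with `m, n ∈ ℤ^g`; comparing the constants of proportionality of the sub-families
`k₀ + Dc` for all `k₀` then gives `e^{2πi ᵗk₀ D⁻¹ m} = 1` for every `k₀ ∈ ℤ^g`, i.e. `m ∈ Dℤ^g`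
(`typeD_lattice_of_proportional`).

Main statements: `levelThreeTheta` (definition), `levelThreeTheta_add_intCast`,
`levelThreeTheta_add_mulVec`, `levelThreeTheta_add_shift`, `typeD_lattice_of_proportional`,
`exists_lefschetz_levelThree_family_typeD` (the package consumed by the torus-side file), and its
`PosDef` form `exists_lefschetz_levelThree_family_typeD_of_posDef`.

## References

* [LangeBirkenhake1992] H. Lange, Ch. Birkenhake, Complex Abelian Varieties (1992), §3.2, Thm. 4.5.1,
  Remark 8.5.3 (classical theta functions `ϑ[c¹ c²]` as a basis of `H⁰(L)` for type `D`).
* [MumfordTata1] D. Mumford, Tata Lectures on Theta I (1983), Ch. II §1 (Thm. 1.3).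
* [GriffithsHarris1978] P. Griffiths, J. Harris, Principles of Algebraic Geometry (1978), Ch. 2 §6.
* [MumfordAV1970] D. Mumford, Abelian Varieties (1970), §3 (Theorem of Lefschetz).
-/

noncomputable section

open Complex Real Finset Filter Topology Matrix
open Literature.Analysis.Complex

namespace Literature.Analysis.SpecialFunctions

variable {g : ℕ}

/-! ### The shifted level-three theta functions -/

/-- **The level-three theta function with characteristic shift `r`**:
`G_r(z) = e^{2πi ᵗr z} ϑ(3z + Ωr, 3Ω)` for `r ∈ ℂ^g` — for `r = c ∈ {0,1,2}^g` the tree's level-three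
family `f_c` (`RiemannThetaLevelThree.lean`), for `r = D⁻¹k` the theta functions of level three and
type `D`; classically `G_r(z) = e^{-3πi ᵗaΩa} ϑ[a, 0](3z, 3Ω)`, `a = r/3`.
[cite: LangeBirkenhake1992, §3.2 and Remark 8.5.3] [cite: MumfordTata1, Ch. II §1 (pp. 122–124)] -/
def levelThreeTheta (Ω : Matrix (Fin g) (Fin g) ℂ) (r z : Fin g → ℂ) : ℂ :=
  cexp (2 * π * I * (r ⬝ᵥ z)) * riemannTheta ((3 : ℂ) • Ω) (fun i => 3 * z i + (Ω *ᵥ r) i)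

/-- Unfolding of `levelThreeTheta`: `G_r(z) = e^{2πi ᵗr z} ϑ(3z + Ωr, 3Ω)`.
[cite: LangeBirkenhake1992, §3.2 and Remark 8.5.3] -/
theorem levelThreeTheta_apply (Ω : Matrix (Fin g) (Fin g) ℂ) (r z : Fin g → ℂ) :
    levelThreeTheta Ω r z =
      cexp (2 * π * I * (r ⬝ᵥ z)) * riemannTheta ((3 : ℂ) • Ω) (fun i => 3 * z i + (Ω *ᵥ r) i) :=
  rfl

/-- For `r = c ∈ {0,1,2}^g` the shifted function IS the tree's principal level-three function
`f_c(z) = e^{2πi ᵗc z} ϑ(3z + Ωc, 3Ω)` (definitionally). [cite: MumfordTata1, Ch. II §1] -/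
theorem levelThreeTheta_natCast (Ω : Matrix (Fin g) (Fin g) ℂ) (c₃ : Fin g → Fin 3)
    (z : Fin g → ℂ) :
    levelThreeTheta Ω (fun i => ((c₃ i : ℕ) : ℂ)) z =
      cexp (2 * π * I * ((fun i => ((c₃ i : ℕ) : ℂ)) ⬝ᵥ z)) *
        riemannTheta ((3 : ℂ) • Ω) (fun i => 3 * z i + (Ω *ᵥ fun j => ((c₃ j : ℕ) : ℂ)) i) :=
  rfl

/-- `G_r` is entire. [cite: MumfordTata1, Ch. II §1] -/
theorem differentiable_levelThreeTheta (Ω : Matrix (Fin g) (Fin g) ℂ) {c : ℝ} (hc : 0 < c)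
    (hY : ∀ x : Fin g → ℝ, c * ∑ i, x i ^ 2 ≤ ∑ i, ∑ j, x i * (Ω i j).im * x j)
    (r : Fin g → ℂ) : Differentiable ℂ (levelThreeTheta Ω r) := by
  have h3 : Differentiable ℂ (riemannTheta ((3 : ℂ) • Ω)) :=
    differentiable_riemannTheta ((3 : ℂ) • Ω) (c := 3 * c) (by positivity) (three_smul_im_bound Ω hY)
  have hlin : Differentiable ℂ fun y : Fin g → ℂ => ∑ i, r i * y i := by fun_prop
  refine Differentiable.mul ?_ (h3.comp ?_)
  · exact (hlin.const_mul (2 * π * I)).cexp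
  · exact differentiable_pi.mpr fun i => by fun_prop

/-- **Behaviour under `ℤ^g`**: `G_r(z + n) = e^{2πi ᵗr n} G_r(z)` for `n ∈ ℤ^g` (`ϑ(·, 3Ω)` is
`ℤ^g`-periodic). [cite: LangeBirkenhake1992, §3.2] -/
theorem levelThreeTheta_add_intCast (Ω : Matrix (Fin g) (Fin g) ℂ) (r z : Fin g → ℂ)
    (n : Fin g → ℤ) :
    levelThreeTheta Ω r (fun i => z i + n i) =
      cexp (2 * π * I * (r ⬝ᵥ fun i => (n i : ℂ))) * levelThreeTheta Ω r z := by
  simp only [levelThreeTheta_apply]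
  have e : (r ⬝ᵥ fun i => z i + n i) = r ⬝ᵥ z + r ⬝ᵥ fun i => (n i : ℂ) := by
    rw [← dotProduct_add]
    rfl
  have e' : (fun i => 3 * (z i + n i) + (Ω *ᵥ r) i) =
      fun i => (3 * z i + (Ω *ᵥ r) i) + ((3 * n i : ℤ) : ℂ) := by
    funext i
    push_cast
    ring
  rw [e, e', riemannTheta_add_intCast ((3 : ℂ) • Ω) _ (fun i => 3 * n i), mul_add, Complex.exp_add]
  ring

/-- **Quasi-periodicity with the factor of automorphy of `L³`**: for symmetric `Ω` and `n ∈ ℤ^g`,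
`G_r(z + Ωn) = exp(-3πi ᵗnΩn - 6πi ᵗn z) G_r(z)` — the SAME factor for every shift `r`.
[cite: LangeBirkenhake1992, §3.2] [cite: MumfordTata1, Ch. II §1] -/
theorem levelThreeTheta_add_mulVec (Ω : Matrix (Fin g) (Fin g) ℂ) (hΩ : ∀ i j, Ω i j = Ω j i)
    (r z : Fin g → ℂ) (n : Fin g → ℤ) :
    levelThreeTheta Ω r (fun i => z i + ∑ j, Ω i j * (n j : ℂ)) =
      cexp (3 * (-(π * I * ∑ i, ∑ j, (n i : ℂ) * Ω i j * (n j : ℂ)) -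
          2 * π * I * ∑ i, (n i : ℂ) * z i)) * levelThreeTheta Ω r z := by
  simp only [levelThreeTheta_apply]
  have h3Ω : ∀ i j, ((3 : ℂ) • Ω) i j = ((3 : ℂ) • Ω) j i := fun i j => by
    simp only [Matrix.smul_apply, hΩ i j]
  have e : (fun i => 3 * (z i + ∑ j, Ω i j * (n j : ℂ)) + (Ω *ᵥ r) i) =
      fun i => (3 * z i + (Ω *ᵥ r) i) + ∑ j, ((3 : ℂ) • Ω) i j * (n j : ℂ) := by
    funext i
    simp only [Matrix.smul_apply, smul_eq_mul, mul_assoc]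
    rw [← Finset.mul_sum]
    ring
  rw [e, riemannTheta_add_mulVec ((3 : ℂ) • Ω) h3Ω _ n]
  set N : Fin g → ℂ := fun i => (n i : ℂ) with hN
  have e1 : (r ⬝ᵥ fun i => z i + ∑ j, Ω i j * (n j : ℂ)) = r ⬝ᵥ z + r ⬝ᵥ (Ω *ᵥ N) := by
    rw [← dotProduct_add]
    rfl
  have e2 : ∑ i, ∑ j, (n i : ℂ) * ((3 : ℂ) • Ω) i j * (n j : ℂ) = 3 * (N ⬝ᵥ (Ω *ᵥ N)) := by
    rw [← sum_sum_mul_mul_eq_dotProduct_mulVec, Finset.mul_sum]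
    refine Finset.sum_congr rfl fun i _ => ?_
    rw [Finset.mul_sum]
    refine Finset.sum_congr rfl fun j _ => ?_
    simp only [Matrix.smul_apply, smul_eq_mul, hN]
    ring
  have e3 : ∑ i, (n i : ℂ) * (3 * z i + (Ω *ᵥ r) i) = 3 * (N ⬝ᵥ z) + N ⬝ᵥ (Ω *ᵥ r) := by
    simp only [dotProduct, Finset.mul_sum, ← Finset.sum_add_distrib, hN]
    refine Finset.sum_congr rfl fun i _ => ?_
    ring
  have e4 : ∑ i, ∑ j, (n i : ℂ) * Ω i j * (n j : ℂ) = N ⬝ᵥ (Ω *ᵥ N) :=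
    sum_sum_mul_mul_eq_dotProduct_mulVec Ω N N
  have e5 : ∑ i, (n i : ℂ) * z i = N ⬝ᵥ z := rfl
  rw [e1, e2, e3, e4, e5, dotProduct_mulVec_comm_of_symm Ω hΩ N r]
  rw [← mul_assoc (cexp _) (cexp _), ← mul_assoc (cexp _) (cexp _), ← Complex.exp_add,
    ← Complex.exp_add]
  congr 2
  ring

/-- **Changing the shift by `3m`, `m ∈ ℤ^g`, multiplies `G_r` by a non-zero constant**:
`G_{r+3m}(z) = exp(-3πi ᵗmΩm - 2πi ᵗmΩr) G_r(z)` (quasi-periodicity of `ϑ(·, 3Ω)` along `3Ωℤ^g`).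
[cite: LangeBirkenhake1992, §3.2] -/
theorem levelThreeTheta_shift_add_intCast (Ω : Matrix (Fin g) (Fin g) ℂ)
    (hΩ : ∀ i j, Ω i j = Ω j i) (r z : Fin g → ℂ) (m : Fin g → ℤ) :
    levelThreeTheta Ω (fun i => r i + 3 * (m i : ℂ)) z =
      cexp (-(3 * (π * I * ∑ i, ∑ j, (m i : ℂ) * Ω i j * (m j : ℂ))) -
          2 * π * I * ∑ i, (m i : ℂ) * (Ω *ᵥ r) i) * levelThreeTheta Ω r z := by
  simp only [levelThreeTheta_apply]
  have h3Ω : ∀ i j, ((3 : ℂ) • Ω) i j = ((3 : ℂ) • Ω) j i := fun i j => by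
    simp only [Matrix.smul_apply, hΩ i j]
  set M : Fin g → ℂ := fun i => (m i : ℂ) with hM
  -- the argument of `ϑ(·, 3Ω)` is shifted by `(3Ω) m`
  have e : (fun i => 3 * z i + (Ω *ᵥ fun i => r i + 3 * (m i : ℂ)) i) =
      fun i => (3 * z i + (Ω *ᵥ r) i) + ∑ j, ((3 : ℂ) • Ω) i j * (m j : ℂ) := by
    funext i
    have : (Ω *ᵥ fun i => r i + 3 * (m i : ℂ)) i = (Ω *ᵥ r) i + ∑ j, ((3 : ℂ) • Ω) i j * (m j : ℂ) := by
      simp only [Matrix.mulVec, dotProduct, Matrix.smul_apply, smul_eq_mul, ← Finset.sum_add_distrib]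
      exact Finset.sum_congr rfl fun j _ => by ring
    rw [this]
    ring
  rw [e, riemannTheta_add_mulVec ((3 : ℂ) • Ω) h3Ω _ m]
  have e1 : ((fun i => r i + 3 * (m i : ℂ)) ⬝ᵥ z) = r ⬝ᵥ z + 3 * (M ⬝ᵥ z) := by
    simp only [dotProduct, hM, Finset.mul_sum, ← Finset.sum_add_distrib]
    exact Finset.sum_congr rfl fun i _ => by ring
  have e2 : ∑ i, ∑ j, (m i : ℂ) * ((3 : ℂ) • Ω) i j * (m j : ℂ) =
      3 * ∑ i, ∑ j, (m i : ℂ) * Ω i j * (m j : ℂ) := by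
    rw [Finset.mul_sum]
    refine Finset.sum_congr rfl fun i _ => ?_
    rw [Finset.mul_sum]
    refine Finset.sum_congr rfl fun j _ => ?_
    simp only [Matrix.smul_apply, smul_eq_mul]
    ring
  have e3 : ∑ i, (m i : ℂ) * (3 * z i + (Ω *ᵥ r) i) = 3 * (M ⬝ᵥ z) + ∑ i, (m i : ℂ) * (Ω *ᵥ r) i := by
    simp only [dotProduct, Finset.mul_sum, ← Finset.sum_add_distrib, hM]
    refine Finset.sum_congr rfl fun i _ => ?_
    ring
  rw [e1, e2, e3]
  rw [← mul_assoc (cexp _) (cexp _), ← mul_assoc (cexp _) (cexp _), ← Complex.exp_add,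
    ← Complex.exp_add]
  congr 2
  ring

/-- **The sub-family identity**: `G_{r+s}(z) = e^{2πi(ᵗr z - ᵗsΩr/3)} · G_s(z + Ωr/3)` — a shifted
level-three function of shift `r + s` is, up to a nowhere-vanishing factor, the function of shift
`s` at the translated point `z + Ωr/3`. For `s = c ∈ {0,1,2}^g` this exhibits the sub-family
`{G_{r+c}}_c` as the principal level-three family at `z + Ωr/3`. [cite: MumfordTata1, Ch. II §1]
[cite: LangeBirkenhake1992, §3.2] -/
theorem levelThreeTheta_add_shift (Ω : Matrix (Fin g) (Fin g) ℂ) (r s z : Fin g → ℂ) :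
    levelThreeTheta Ω (r + s) z =
      cexp (2 * π * I * (r ⬝ᵥ z) - 2 * π * I * (s ⬝ᵥ (Ω *ᵥ r)) / 3) *
        levelThreeTheta Ω s (fun i => z i + (Ω *ᵥ r) i / 3) := by
  simp only [levelThreeTheta_apply]
  have e : (fun i => 3 * (z i + (Ω *ᵥ r) i / 3) + (Ω *ᵥ s) i) = fun i => 3 * z i + (Ω *ᵥ (r + s)) i := by
    funext i
    rw [Matrix.mulVec_add, Pi.add_apply]
    ring
  rw [e, ← mul_assoc, ← Complex.exp_add]
  congr 2
  have e1 : (r + s) ⬝ᵥ z = r ⬝ᵥ z + s ⬝ᵥ z := add_dotProduct r s z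
  have e2 : (s ⬝ᵥ fun i => z i + (Ω *ᵥ r) i / 3) = s ⬝ᵥ z + (s ⬝ᵥ (Ω *ᵥ r)) / 3 := by
    simp only [dotProduct, Finset.sum_div, ← Finset.sum_add_distrib]
    exact Finset.sum_congr rfl fun i _ => by ring
  rw [e1, e2]
  ring

/-! ### The principal family through the cubic product formula -/

/-- The cubic product formula, read for `levelThreeTheta`: every `ϑ(z+a)ϑ(z+b)ϑ(z-a-b)` is a
combination of the principal functions `G_c`, `c ∈ {0,1,2}^g`. [cite: MumfordTata1, Ch. II §1 (pp. 122–124)] -/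
theorem levelThreeTheta_cubic_span (Ω : Matrix (Fin g) (Fin g) ℂ) (hΩ : ∀ i j, Ω i j = Ω j i)
    {c : ℝ} (hc : 0 < c)
    (hY : ∀ x : Fin g → ℝ, c * ∑ i, x i ^ 2 ≤ ∑ i, ∑ j, x i * (Ω i j).im * x j)
    (a b : Fin g → ℂ) :
    ∃ Λ : (Fin g → Fin 3) → ℂ, ∀ z : Fin g → ℂ,
      riemannTheta Ω (z + a) * riemannTheta Ω (z + b) * riemannTheta Ω (z - a - b) =
        ∑ c₃, Λ c₃ * levelThreeTheta Ω (fun i => ((c₃ i : ℕ) : ℂ)) z := by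
  refine ⟨fun c₃ => ∑' p : (Fin g → ℤ) × (Fin g → ℤ),
    riemannThetaTerm Ω a (fun i => ((c₃ i : ℕ) : ℤ) - p.1 i - p.2 i) *
      riemannThetaTerm Ω b p.1 * riemannThetaTerm Ω (-a - b) p.2, fun z => ?_⟩
  rw [riemannTheta_mul_mul_eq_sum_levelThree Ω hΩ hc hY z a b]
  rfl

/-- **The principal level-three functions have no common zero.** [cite: MumfordTata1, Ch. II §1 Thm. 1.3] -/
theorem exists_levelThreeTheta_natCast_ne_zero (Ω : Matrix (Fin g) (Fin g) ℂ)
    (hΩ : ∀ i j, Ω i j = Ω j i) {c : ℝ} (hc : 0 < c)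
    (hY : ∀ x : Fin g → ℝ, c * ∑ i, x i ^ 2 ≤ ∑ i, ∑ j, x i * (Ω i j).im * x j)
    (z : Fin g → ℂ) : ∃ c₃ : Fin g → Fin 3, levelThreeTheta Ω (fun i => ((c₃ i : ℕ) : ℂ)) z ≠ 0 := by
  have hP := levelThreeTheta_cubic_span Ω hΩ hc hY
  exact exists_apply_ne_zero_of_cubic_span Ω hc hY
    (fun c₃ : Fin g → Fin 3 => levelThreeTheta Ω fun i => ((c₃ i : ℕ) : ℂ)) hP z

/-- **The principal level-three functions separate points modulo `ℤ^g + Ωℤ^g`.**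
[cite: MumfordTata1, Ch. II §1 Thm. 1.3] -/
theorem lattice_of_levelThreeTheta_natCast_proportional (Ω : Matrix (Fin g) (Fin g) ℂ)
    (hΩ : ∀ i j, Ω i j = Ω j i) {c : ℝ} (hc : 0 < c)
    (hY : ∀ x : Fin g → ℝ, c * ∑ i, x i ^ 2 ≤ ∑ i, ∑ j, x i * (Ω i j).im * x j)
    {z₁ z₂ : Fin g → ℂ} {γ : ℂ}
    (hγ : ∀ c₃ : Fin g → Fin 3, levelThreeTheta Ω (fun i => ((c₃ i : ℕ) : ℂ)) z₂ =
      γ * levelThreeTheta Ω (fun i => ((c₃ i : ℕ) : ℂ)) z₁) :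
    ∃ m n : Fin g → ℤ, ∀ i, z₂ i - z₁ i = (m i : ℂ) + ∑ j, Ω i j * (n j : ℂ) := by
  have hP := levelThreeTheta_cubic_span Ω hΩ hc hY
  exact lattice_of_proportional_of_cubic_span Ω hΩ hc hY
    (fun c₃ : Fin g → Fin 3 => levelThreeTheta Ω fun i => ((c₃ i : ℕ) : ℂ)) hP hγ

/-- **The principal level-three functions separate tangent vectors.** [cite: MumfordTata1, Ch. II §1 Thm. 1.3] -/
theorem eq_zero_of_fderiv_levelThreeTheta_natCast (Ω : Matrix (Fin g) (Fin g) ℂ)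
    (hΩ : ∀ i j, Ω i j = Ω j i) {c : ℝ} (hc : 0 < c)
    (hY : ∀ x : Fin g → ℝ, c * ∑ i, x i ^ 2 ≤ ∑ i, ∑ j, x i * (Ω i j).im * x j)
    {z v : Fin g → ℂ} {μ : ℂ}
    (hμ : ∀ c₃ : Fin g → Fin 3, fderiv ℂ (levelThreeTheta Ω fun i => ((c₃ i : ℕ) : ℂ)) z v =
      μ * levelThreeTheta Ω (fun i => ((c₃ i : ℕ) : ℂ)) z) : v = 0 := by
  have hP := levelThreeTheta_cubic_span Ω hΩ hc hY
  exact tangent_eq_zero_of_cubic_span Ω hΩ hc hY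
    (fun c₃ : Fin g → Fin 3 => levelThreeTheta Ω fun i => ((c₃ i : ℕ) : ℂ))
    (fun c₃ => differentiable_levelThreeTheta Ω hc hY _) hP hμ

/-! ### The constant of proportionality of a shifted sub-family -/

/-- **The constant of proportionality is determined by the shift.** If `z₂ = z₁ + m + Ωn`
(`m, n ∈ ℤ^g`) and the sub-family `{G_{r+c}}_{c ∈ {0,1,2}^g}` takes proportional values at `z₂` and
`z₁`, `G_{r+c}(z₂) = γ G_{r+c}(z₁)` for all `c`, then
`γ = e^{2πi ᵗr m} · exp(-3πi ᵗnΩn - 6πi ᵗn z₁)`: by `levelThreeTheta_add_shift` the sub-family is the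
principal family at `z + Ωr/3` (which has no common zero), and the principal family is `ℤ^g`-periodic
with the common factor of automorphy along `Ωℤ^g`. [cite: GriffithsHarris1978, Ch. 2 §6 (proof of the Lefschetz theorem)]
[cite: LangeBirkenhake1992, Thm. 4.5.1] -/
theorem eq_cexp_of_levelThreeTheta_shift_proportional (Ω : Matrix (Fin g) (Fin g) ℂ)
    (hΩ : ∀ i j, Ω i j = Ω j i) {c : ℝ} (hc : 0 < c)
    (hY : ∀ x : Fin g → ℝ, c * ∑ i, x i ^ 2 ≤ ∑ i, ∑ j, x i * (Ω i j).im * x j)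
    (r : Fin g → ℂ) {z₁ z₂ : Fin g → ℂ} {m n : Fin g → ℤ}
    (hw : ∀ i, z₂ i - z₁ i = (m i : ℂ) + ∑ j, Ω i j * (n j : ℂ)) {γ : ℂ}
    (hγ : ∀ c₃ : Fin g → Fin 3, levelThreeTheta Ω (r + fun i => ((c₃ i : ℕ) : ℂ)) z₂ =
      γ * levelThreeTheta Ω (r + fun i => ((c₃ i : ℕ) : ℂ)) z₁) :
    γ = cexp (2 * π * I * (r ⬝ᵥ fun i => (m i : ℂ))) *
      cexp (3 * (-(π * I * ∑ i, ∑ j, (n i : ℂ) * Ω i j * (n j : ℂ)) -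
        2 * π * I * ∑ i, (n i : ℂ) * z₁ i)) := by
  -- the translated base point `z₁ + Ωr/3` and a principal function not vanishing there
  set a : Fin g → ℂ := fun i => (Ω *ᵥ r) i / 3 with ha
  obtain ⟨c₃, hc₃⟩ := exists_levelThreeTheta_natCast_ne_zero Ω hΩ hc hY (fun i => z₁ i + a i)
  set C : Fin g → ℂ := fun i => ((c₃ i : ℕ) : ℂ) with hC
  set N : Fin g → ℂ := fun i => (n i : ℂ) with hN
  set M : Fin g → ℂ := fun i => (m i : ℂ) with hM
  -- the sub-family identity at `z₂` and at `z₁`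
  have h2 := levelThreeTheta_add_shift Ω r C z₂
  have h1 := levelThreeTheta_add_shift Ω r C z₁
  -- `z₂ + a = ((z₁ + a) + Ωn) + m`
  have hz : (fun i => z₂ i + (Ω *ᵥ r) i / 3) =
      fun i => (fun i => (z₁ i + a i) + ∑ j, Ω i j * (n j : ℂ)) i + (m i : ℂ) := by
    funext i
    have := hw i
    simp only [ha]
    linear_combination this
  have hper : levelThreeTheta Ω C (fun i => z₂ i + (Ω *ᵥ r) i / 3) =
      cexp (3 * (-(π * I * ∑ i, ∑ j, (n i : ℂ) * Ω i j * (n j : ℂ)) -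
        2 * π * I * ∑ i, (n i : ℂ) * (z₁ i + a i))) * levelThreeTheta Ω C (fun i => z₁ i + a i) := by
    rw [hz, levelThreeTheta_add_intCast, levelThreeTheta_add_mulVec Ω hΩ]
    have h1' : cexp (2 * π * I * (C ⬝ᵥ fun i => (m i : ℂ))) = 1 := by
      simp only [hC]
      exact cexp_two_pi_I_natCast_dotProduct_intCast c₃ m
    rw [h1', one_mul]
  -- compare the two expressions for `G_{r+c}(z₂)`
  have key := hγ c₃
  rw [h2, h1, hper] at key
  -- cancel the non-zero common factor `G_c(z₁ + a)`
  have hE1 : cexp (2 * π * I * (r ⬝ᵥ z₁) - 2 * π * I * (C ⬝ᵥ (Ω *ᵥ r)) / 3) ≠ 0 :=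
    Complex.exp_ne_zero _
  have hne : cexp (2 * π * I * (r ⬝ᵥ z₁) - 2 * π * I * (C ⬝ᵥ (Ω *ᵥ r)) / 3) *
      levelThreeTheta Ω C (fun i => z₁ i + a i) ≠ 0 := mul_ne_zero hE1 hc₃
  have key' : cexp (2 * π * I * (r ⬝ᵥ z₂) - 2 * π * I * (C ⬝ᵥ (Ω *ᵥ r)) / 3) *
      cexp (3 * (-(π * I * ∑ i, ∑ j, (n i : ℂ) * Ω i j * (n j : ℂ)) -
        2 * π * I * ∑ i, (n i : ℂ) * (z₁ i + a i))) =
      γ * cexp (2 * π * I * (r ⬝ᵥ z₁) - 2 * π * I * (C ⬝ᵥ (Ω *ᵥ r)) / 3) := by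
    apply mul_right_cancel₀ hc₃
    linear_combination key
  -- solve for `γ`
  have hγeq : γ = cexp (2 * π * I * (r ⬝ᵥ z₂) - 2 * π * I * (C ⬝ᵥ (Ω *ᵥ r)) / 3) *
      cexp (3 * (-(π * I * ∑ i, ∑ j, (n i : ℂ) * Ω i j * (n j : ℂ)) -
        2 * π * I * ∑ i, (n i : ℂ) * (z₁ i + a i))) *
      cexp (-(2 * π * I * (r ⬝ᵥ z₁) - 2 * π * I * (C ⬝ᵥ (Ω *ᵥ r)) / 3)) := by
    rw [key', mul_assoc, ← Complex.exp_add, add_neg_cancel, Complex.exp_zero, mul_one]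
  rw [hγeq, ← Complex.exp_add, ← Complex.exp_add, ← Complex.exp_add]
  congr 1
  -- the exponents agree: `ᵗr(z₂ - z₁) = ᵗr m + ᵗr Ω n` and `3 ᵗn a = ᵗn Ω r = ᵗr Ω n`
  have hw' : z₂ = fun i => z₁ i + (M i + ∑ j, Ω i j * (n j : ℂ)) := by
    funext i
    have := hw i
    simp only [hM]
    linear_combination this
  have e1 : r ⬝ᵥ z₂ = r ⬝ᵥ z₁ + r ⬝ᵥ M + r ⬝ᵥ (Ω *ᵥ N) := by
    rw [hw']
    simp only [dotProduct, Matrix.mulVec, hN, ← Finset.sum_add_distrib]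
    exact Finset.sum_congr rfl fun i _ => by ring
  have e2 : ∑ i, (n i : ℂ) * (z₁ i + a i) = N ⬝ᵥ z₁ + (N ⬝ᵥ (Ω *ᵥ r)) / 3 := by
    simp only [dotProduct, ha, hN, Finset.sum_div, ← Finset.sum_add_distrib]
    exact Finset.sum_congr rfl fun i _ => by ring
  have e3 : ∑ i, (n i : ℂ) * z₁ i = N ⬝ᵥ z₁ := rfl
  have e4 : (r ⬝ᵥ fun i => (m i : ℂ)) = r ⬝ᵥ M := rfl
  rw [e1, e2, e3, e4, dotProduct_mulVec_comm_of_symm Ω hΩ N r]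
  ring

/-! ### The type-`D` family separates points modulo `Dℤ^g ⊕ Ωℤ^g` -/

/-- The shift of the index `(dᵢcᵢ)ᵢ` is the integer vector `c`: `dᵢcᵢ/dᵢ = cᵢ`. [folklore] -/
private theorem typeDShift_mul (d : Fin g → ℕ) (hd : ∀ i, 0 < d i) (c₃ : Fin g → Fin 3) :
    (fun i => ((d i * (c₃ i : ℕ) : ℕ) : ℂ) / (d i : ℂ)) = fun i => ((c₃ i : ℕ) : ℂ) := by
  funext i
  have hdi : (d i : ℂ) ≠ 0 := Nat.cast_ne_zero.mpr (hd i).ne'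
  push_cast
  field_simp

/-- The shift of the index `(δᵢᵢ₀ + dᵢcᵢ)ᵢ` is `eᵢ₀/dᵢ₀ + c`. [folklore] -/
private theorem typeDShift_single_add_mul (d : Fin g → ℕ) (hd : ∀ i, 0 < d i) (i₀ : Fin g)
    (c₃ : Fin g → Fin 3) :
    (fun i => (((if i = i₀ then 1 else 0) + d i * (c₃ i : ℕ) : ℕ) : ℂ) / (d i : ℂ)) =
      (fun i => (if i = i₀ then 1 else 0 : ℂ) / (d i : ℂ)) + fun i => ((c₃ i : ℕ) : ℂ) := by
  funext i
  have hdi : (d i : ℂ) ≠ 0 := Nat.cast_ne_zero.mpr (hd i).ne'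
  simp only [Pi.add_apply]
  push_cast
  field_simp

/-- **The type-`D` level-three functions separate points modulo `Dℤ^g ⊕ Ωℤ^g`.** For symmetric `Ω`
with `Im Ω ≥ c > 0` and `D = diag(d)`, `dᵢ ≥ 1`: if the functions
`G_k(z) = e^{2πi ᵗk D⁻¹ z} ϑ(3z + ΩD⁻¹k, 3Ω)`, `0 ≤ kᵢ < 3dᵢ`, take proportional values at `z₂` and
`z₁` then `z₂ - z₁ = Dm + Ωn` with `m, n ∈ ℤ^g`. (The principal sub-family `k = Dc` gives
`z₂ - z₁ = m + Ωn`; the sub-families `k = eᵢ₀ + Dc` then force `e^{2πi mᵢ₀/dᵢ₀} = 1`.)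
[cite: LangeBirkenhake1992, Thm. 4.5.1] [cite: GriffithsHarris1978, Ch. 2 §6 (The Lefschetz theorem)] -/
theorem typeD_lattice_of_proportional (Ω : Matrix (Fin g) (Fin g) ℂ) (hΩ : ∀ i j, Ω i j = Ω j i)
    {c : ℝ} (hc : 0 < c)
    (hY : ∀ x : Fin g → ℝ, c * ∑ i, x i ^ 2 ≤ ∑ i, ∑ j, x i * (Ω i j).im * x j)
    (d : Fin g → ℕ) (hd : ∀ i, 0 < d i) {z₁ z₂ : Fin g → ℂ} {γ : ℂ}
    (hγ : ∀ k : (i : Fin g) → Fin (3 * d i),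
      levelThreeTheta Ω (fun i => ((k i : ℕ) : ℂ) / (d i : ℂ)) z₂ =
        γ * levelThreeTheta Ω (fun i => ((k i : ℕ) : ℂ) / (d i : ℂ)) z₁) :
    ∃ m n : Fin g → ℤ, ∀ i, z₂ i - z₁ i = (d i : ℂ) * (m i : ℂ) + ∑ j, Ω i j * (n j : ℂ) := by
  -- the principal sub-family `k = Dc`
  have hDc : ∀ c₃ : Fin g → Fin 3, ∀ i, d i * (c₃ i : ℕ) < 3 * d i := fun c₃ i => by
    have hc2 : (c₃ i : ℕ) ≤ 2 := by have := (c₃ i).isLt; omega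
    have := Nat.mul_le_mul_left (d i) hc2
    have := hd i
    omega
  have hγ0 : ∀ c₃ : Fin g → Fin 3, levelThreeTheta Ω (fun i => ((c₃ i : ℕ) : ℂ)) z₂ =
      γ * levelThreeTheta Ω (fun i => ((c₃ i : ℕ) : ℂ)) z₁ := by
    intro c₃
    have h := hγ fun i => ⟨d i * (c₃ i : ℕ), hDc c₃ i⟩
    dsimp only at h
    rwa [typeDShift_mul d hd c₃] at h
  obtain ⟨m, n, hw⟩ := lattice_of_levelThreeTheta_natCast_proportional Ω hΩ hc hY hγ0
  -- `γ` from the principal sub-family (shift `r = 0`)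
  have hγ0' : ∀ c₃ : Fin g → Fin 3, levelThreeTheta Ω (0 + fun i => ((c₃ i : ℕ) : ℂ)) z₂ =
      γ * levelThreeTheta Ω (0 + fun i => ((c₃ i : ℕ) : ℂ)) z₁ := fun c₃ => by
    rw [zero_add]
    exact hγ0 c₃
  have hγval := eq_cexp_of_levelThreeTheta_shift_proportional Ω hΩ hc hY 0 hw hγ0'
  rw [zero_dotProduct, mul_zero, Complex.exp_zero, one_mul] at hγval
  -- for each `i₀`, `γ` from the sub-family `k = eᵢ₀ + Dc` (shift `eᵢ₀/dᵢ₀`)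
  have hdiv : ∀ i₀ : Fin g, ∃ q : ℤ, m i₀ = d i₀ * q := by
    intro i₀
    -- nothing to prove when `dᵢ₀ = 1`
    by_cases hd1 : d i₀ = 1
    · exact ⟨m i₀, by rw [hd1]; simp⟩
    have hd2 : 2 ≤ d i₀ := by have := hd i₀; omega
    set r : Fin g → ℂ := fun i => (if i = i₀ then 1 else 0 : ℂ) / (d i : ℂ) with hr
    have hlt : ∀ c₃ : Fin g → Fin 3, ∀ i, (if i = i₀ then 1 else 0) + d i * (c₃ i : ℕ) < 3 * d i :=
      fun c₃ i => by
        have hc2 : (c₃ i : ℕ) ≤ 2 := by have := (c₃ i).isLt; omega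
        have := Nat.mul_le_mul_left (d i) hc2
        have := hd i
        split_ifs with h
        · have hd2' : 2 ≤ d i := by rw [h]; exact hd2
          omega
        · omega
    have hγr : ∀ c₃ : Fin g → Fin 3, levelThreeTheta Ω (r + fun i => ((c₃ i : ℕ) : ℂ)) z₂ =
        γ * levelThreeTheta Ω (r + fun i => ((c₃ i : ℕ) : ℂ)) z₁ := by
      intro c₃
      have h := hγ fun i => ⟨(if i = i₀ then 1 else 0) + d i * (c₃ i : ℕ), hlt c₃ i⟩
      dsimp only at h
      rwa [typeDShift_single_add_mul d hd i₀ c₃] at h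
    have hγval' := eq_cexp_of_levelThreeTheta_shift_proportional Ω hΩ hc hY r hw hγr
    rw [hγval] at hγval'
    -- `exp(2πi ᵗr m) = 1`, `ᵗr m = mᵢ₀/dᵢ₀`
    have hQ : cexp (3 * (-(π * I * ∑ i, ∑ j, (n i : ℂ) * Ω i j * (n j : ℂ)) -
        2 * π * I * ∑ i, (n i : ℂ) * z₁ i)) ≠ 0 := Complex.exp_ne_zero _
    have hone : cexp (2 * π * I * (r ⬝ᵥ fun i => (m i : ℂ))) = 1 := by
      have := hγval'
      conv_lhs at this => rw [← one_mul (cexp _)]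
      exact (mul_right_cancel₀ hQ this).symm
    have hrm : (r ⬝ᵥ fun i => (m i : ℂ)) = (m i₀ : ℂ) / (d i₀ : ℂ) := by
      simp only [dotProduct, hr]
      rw [Finset.sum_eq_single i₀]
      · simp
        ring
      · intro b _ hb
        simp [hb]
      · intro h
        exact absurd (Finset.mem_univ i₀) h
    rw [hrm] at hone
    obtain ⟨q, hq⟩ := Complex.exp_eq_one_iff.mp hone
    have hdi : (d i₀ : ℂ) ≠ 0 := Nat.cast_ne_zero.mpr (hd i₀).ne'
    have h2pi : (2 * π * I : ℂ) ≠ 0 := by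
      have : (π : ℂ) ≠ 0 := Complex.ofReal_ne_zero.mpr Real.pi_ne_zero
      exact mul_ne_zero (mul_ne_zero two_ne_zero this) Complex.I_ne_zero
    refine ⟨q, ?_⟩
    have h1 : (m i₀ : ℂ) / (d i₀ : ℂ) = (q : ℂ) :=
      mul_right_cancel₀ h2pi (by rw [mul_comm]; exact hq)
    have hq' : (m i₀ : ℂ) = (d i₀ : ℂ) * (q : ℂ) := by
      rw [div_eq_iff hdi] at h1
      rw [h1]
      ring
    exact_mod_cast hq'
  choose q hq using hdiv
  refine ⟨q, n, fun i => ?_⟩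
  rw [hw i, hq i]
  push_cast
  ring

/-! ### Lefschetz's theorem for `ℂ^g/(Dℤ^g ⊕ Ωℤ^g)`, analytic form -/

/-- `e^{2πi ᵗ(D⁻¹k)(Dn)} = 1`: the type-`D` functions are `Dℤ^g`-periodic. [folklore] -/
private theorem cexp_typeDShift_dotProduct_eq_one (d : Fin g → ℕ) (hd : ∀ i, 0 < d i) (k : Fin g → ℕ)
    (n : Fin g → ℤ) :
    cexp (2 * π * I * ((fun i => (k i : ℂ) / (d i : ℂ)) ⬝ᵥ fun i => (((d i : ℤ) * n i : ℤ) : ℂ))) = 1 := by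
  have h : ((fun i => (k i : ℂ) / (d i : ℂ)) ⬝ᵥ fun i => (((d i : ℤ) * n i : ℤ) : ℂ)) =
      ((∑ i, (k i : ℤ) * n i : ℤ) : ℂ) := by
    simp only [dotProduct]
    push_cast
    refine Finset.sum_congr rfl fun i _ => ?_
    have hdi : (d i : ℂ) ≠ 0 := Nat.cast_ne_zero.mpr (hd i).ne'
    field_simp
  rw [h, show 2 * (π : ℂ) * I * ((∑ i, (k i : ℤ) * n i : ℤ) : ℂ) =
    ((∑ i, (k i : ℤ) * n i : ℤ) : ℂ) * (2 * π * I) by ring]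
  exact Complex.exp_int_mul_two_pi_mul_I _

/-- **Lefschetz's theorem for `ℂ^g/(Dℤ^g ⊕ Ωℤ^g)`, analytic form.** For symmetric `Ω` with
`Im Ω ≥ c > 0` and positive integers `d₁, …, d_g` there is a finite family `(G_k)`,
`k ∈ ∏ᵢ {0, …, 3dᵢ - 1}`, of entire functions on `ℂ^g` which (i) are `Dℤ^g`-periodic
(`D = diag(d)`), (ii) satisfy the common quasi-periodicity `G_k(z + Ωn) = exp(-3πi ᵗnΩn - 6πi ᵗn z) G_k(z)`,
`n ∈ ℤ^g` (so that `z ↦ [G_k(z)]_k` is well defined on the torus `ℂ^g/(Dℤ^g ⊕ Ωℤ^g)`), (iii) have no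
common zero, (iv) separate points modulo the lattice — `G_k(z₂) = γ G_k(z₁)` for all `k` forces
`z₂ - z₁ ∈ Dℤ^g + Ωℤ^g` — and (v) separate tangent vectors — `∂_v G_k(z) = μ G_k(z)` for all `k`
forces `v = 0`. The family is `G_k(z) = e^{2πi ᵗk D⁻¹ z} ϑ(3z + ΩD⁻¹k, 3Ω)` (`levelThreeTheta` with
shift `D⁻¹k`), the classical basis of sections of `L³` for `L` of type `D`.
[cite: LangeBirkenhake1992, Thm. 4.5.1] [cite: MumfordTata1, Ch. II §1 Thm. 1.3]
[cite: GriffithsHarris1978, Ch. 2 §6 (The Lefschetz theorem)] [cite: MumfordAV1970, §3 (Theorem of Lefschetz)] -/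
theorem exists_lefschetz_levelThree_family_typeD (Ω : Matrix (Fin g) (Fin g) ℂ)
    (hΩ : ∀ i j, Ω i j = Ω j i) {c : ℝ} (hc : 0 < c)
    (hY : ∀ x : Fin g → ℝ, c * ∑ i, x i ^ 2 ≤ ∑ i, ∑ j, x i * (Ω i j).im * x j)
    (d : Fin g → ℕ) (hd : ∀ i, 0 < d i) :
    ∃ f : ((i : Fin g) → Fin (3 * d i)) → (Fin g → ℂ) → ℂ,
      (∀ k, Differentiable ℂ (f k)) ∧
      (∀ k (z : Fin g → ℂ) (n : Fin g → ℤ), f k (fun i => z i + (d i : ℂ) * (n i : ℂ)) = f k z) ∧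
      (∀ k (z : Fin g → ℂ) (n : Fin g → ℤ),
        f k (fun i => z i + ∑ j, Ω i j * (n j : ℂ)) =
          cexp (3 * (-(π * I * ∑ i, ∑ j, (n i : ℂ) * Ω i j * (n j : ℂ)) -
            2 * π * I * ∑ i, (n i : ℂ) * z i)) * f k z) ∧
      (∀ z : Fin g → ℂ, ∃ k, f k z ≠ 0) ∧
      (∀ (z₁ z₂ : Fin g → ℂ) (γ : ℂ), (∀ k, f k z₂ = γ * f k z₁) →
        ∃ m n : Fin g → ℤ, ∀ i, z₂ i - z₁ i = (d i : ℂ) * (m i : ℂ) + ∑ j, Ω i j * (n j : ℂ)) ∧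
      (∀ (z v : Fin g → ℂ) (μ : ℂ), (∀ k, fderiv ℂ (f k) z v = μ * f k z) → v = 0) := by
  -- the principal indices `k = Dc`, `c ∈ {0,1,2}^g`, lie in the index range
  have hDc : ∀ c₃ : Fin g → Fin 3, ∀ i, d i * (c₃ i : ℕ) < 3 * d i := fun c₃ i => by
    have hc2 : (c₃ i : ℕ) ≤ 2 := by have := (c₃ i).isLt; omega
    have := Nat.mul_le_mul_left (d i) hc2
    have := hd i
    omega
  have hsub : ∀ c₃ : Fin g → Fin 3,
      (fun z => levelThreeTheta Ω
        (fun i => (((fun i => (⟨d i * (c₃ i : ℕ), hDc c₃ i⟩ : Fin (3 * d i))) i : ℕ) : ℂ) / (d i : ℂ)) z) =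
      levelThreeTheta Ω (fun i => ((c₃ i : ℕ) : ℂ)) := by
    intro c₃
    funext z
    dsimp only
    rw [typeDShift_mul d hd c₃]
  refine ⟨fun k z => levelThreeTheta Ω (fun i => ((k i : ℕ) : ℂ) / (d i : ℂ)) z,
    fun k => differentiable_levelThreeTheta Ω hc hY _, fun k z n => ?_,
    fun k z n => levelThreeTheta_add_mulVec Ω hΩ _ z n, fun z => ?_,
    fun z₁ z₂ γ hγ => typeD_lattice_of_proportional Ω hΩ hc hY d hd hγ, fun z v μ hμ => ?_⟩
  · -- `Dℤ^g`-periodicity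
    have e : (fun i => z i + (d i : ℂ) * (n i : ℂ)) = fun i => z i + ((((d i : ℤ) * n i : ℤ)) : ℂ) := by
      funext i
      push_cast
      ring
    dsimp only
    rw [e, levelThreeTheta_add_intCast,
      cexp_typeDShift_dotProduct_eq_one d hd (fun i => (k i : ℕ)) n, one_mul]
  · -- no common zero: already the principal sub-family has none
    obtain ⟨c₃, hc₃⟩ := exists_levelThreeTheta_natCast_ne_zero Ω hΩ hc hY z
    refine ⟨fun i => ⟨d i * (c₃ i : ℕ), hDc c₃ i⟩, ?_⟩
    have := congrFun (hsub c₃) z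
    dsimp only at this ⊢
    rwa [this]
  · -- separation of tangent vectors: already by the principal sub-family
    refine eq_zero_of_fderiv_levelThreeTheta_natCast Ω hΩ hc hY (z := z) (μ := μ) fun c₃ => ?_
    have h := hμ fun i => ⟨d i * (c₃ i : ℕ), hDc c₃ i⟩
    dsimp only at h
    rw [typeDShift_mul d hd c₃] at h
    exact h

/-- **Lefschetz's theorem for `ℂ^g/(Dℤ^g ⊕ Ωℤ^g)`, analytic form, for `Ω` in the Siegel upper half
space** (`Ω` symmetric with positive definite imaginary part) and any polarisation type
`D = diag(d₁, …, d_g)`, `dᵢ ≥ 1`. [cite: LangeBirkenhake1992, Thm. 4.5.1]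
[cite: MumfordTata1, Ch. II §1 Thm. 1.3] -/
theorem exists_lefschetz_levelThree_family_typeD_of_posDef (Ω : Matrix (Fin g) (Fin g) ℂ)
    (hΩ : ∀ i j, Ω i j = Ω j i) (hpos : (Matrix.of fun i j => (Ω i j).im).PosDef)
    (d : Fin g → ℕ) (hd : ∀ i, 0 < d i) :
    ∃ f : ((i : Fin g) → Fin (3 * d i)) → (Fin g → ℂ) → ℂ,
      (∀ k, Differentiable ℂ (f k)) ∧
      (∀ k (z : Fin g → ℂ) (n : Fin g → ℤ), f k (fun i => z i + (d i : ℂ) * (n i : ℂ)) = f k z) ∧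
      (∀ k (z : Fin g → ℂ) (n : Fin g → ℤ),
        f k (fun i => z i + ∑ j, Ω i j * (n j : ℂ)) =
          cexp (3 * (-(π * I * ∑ i, ∑ j, (n i : ℂ) * Ω i j * (n j : ℂ)) -
            2 * π * I * ∑ i, (n i : ℂ) * z i)) * f k z) ∧
      (∀ z : Fin g → ℂ, ∃ k, f k z ≠ 0) ∧
      (∀ (z₁ z₂ : Fin g → ℂ) (γ : ℂ), (∀ k, f k z₂ = γ * f k z₁) →
        ∃ m n : Fin g → ℤ, ∀ i, z₂ i - z₁ i = (d i : ℂ) * (m i : ℂ) + ∑ j, Ω i j * (n j : ℂ)) ∧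
      (∀ (z v : Fin g → ℂ) (μ : ℂ), (∀ k, fderiv ℂ (f k) z v = μ * f k z) → v = 0) := by
  obtain ⟨c, hc, hY⟩ := exists_pos_mul_sum_sq_le_of_posDef_im Ω hpos
  exact exists_lefschetz_levelThree_family_typeD Ω hΩ hc hY d hd

/-! ### Bridge to the theta functions with characteristics -/

/-- **`G_r(z) = e^{-πi ᵗrΩr/3} · ϑ[r/3; 0](3z, 3Ω)`** for symmetric `Ω` and every shift `r ∈ ℂ^g`:
the shifted level-three functions ARE the classical theta functions with characteristics
(`riemannThetaChar` of `RiemannThetaCharacteristics.lean`) up to non-zero constants — for `r = D⁻¹k`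
the classical basis `ϑ[(3D)⁻¹k; 0](3z, 3Ω)` of `H⁰(L³)`, `L` of type `D` (Lange–Birkenhake §3.2,
Remark 8.5.3); for `r = c ∈ {0,1,2}^g` this is `levelThree_eq_cexp_mul_riemannThetaChar`.
[cite: LangeBirkenhake1992, §3.2 and Remark 8.5.3] [cite: MumfordTata1, Ch. II §1 (pp. 122–124)] -/
theorem levelThreeTheta_eq_cexp_mul_riemannThetaChar (Ω : Matrix (Fin g) (Fin g) ℂ)
    (hΩ : ∀ i j, Ω i j = Ω j i) (r z : Fin g → ℂ) :
    levelThreeTheta Ω r z =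
      cexp (-(π * I * (r ⬝ᵥ (Ω *ᵥ r)) / 3)) *
        riemannThetaChar ((3 : ℂ)⁻¹ • r) 0 ((3 : ℂ) • Ω) ((3 : ℂ) • z) := by
  have h3 : ∀ i j, ((3 : ℂ) • Ω) i j = ((3 : ℂ) • Ω) j i := fun i j => by
    simp only [Matrix.smul_apply, hΩ i j]
  rw [levelThreeTheta_apply, riemannThetaChar_eq_cexp_mul_riemannTheta ((3 : ℂ) • Ω) h3]
  have hΩr : ((3 : ℂ) • Ω) *ᵥ ((3 : ℂ)⁻¹ • r) = Ω *ᵥ r := by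
    rw [Matrix.mulVec_smul, Matrix.smul_mulVec, smul_smul]
    norm_num
  have harg : (3 : ℂ) • z + ((3 : ℂ) • Ω) *ᵥ ((3 : ℂ)⁻¹ • r) + 0 = fun i => 3 * z i + (Ω *ᵥ r) i := by
    rw [hΩr, add_zero]
    funext i
    simp
  rw [harg, ← mul_assoc, ← Complex.exp_add]
  congr 2
  simp only [hΩr, add_zero, smul_dotProduct, dotProduct_smul, smul_eq_mul]
  ring

/-- The non-zero constant in the bridge: the type-`D` / shifted level-three functions and the
classical `ϑ[r/3; 0](3z, 3Ω)` have the same zeros and define the same map to projective space.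
[cite: LangeBirkenhake1992, §3.2 and Remark 8.5.3] -/
theorem riemannThetaChar_eq_cexp_mul_levelThreeTheta (Ω : Matrix (Fin g) (Fin g) ℂ)
    (hΩ : ∀ i j, Ω i j = Ω j i) (r z : Fin g → ℂ) :
    riemannThetaChar ((3 : ℂ)⁻¹ • r) 0 ((3 : ℂ) • Ω) ((3 : ℂ) • z) =
      cexp (π * I * (r ⬝ᵥ (Ω *ᵥ r)) / 3) * levelThreeTheta Ω r z := by
  rw [levelThreeTheta_eq_cexp_mul_riemannThetaChar Ω hΩ, ← mul_assoc, ← Complex.exp_add,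
    show π * I * (r ⬝ᵥ (Ω *ᵥ r)) / 3 + -(π * I * (r ⬝ᵥ (Ω *ᵥ r)) / 3) = 0 by ring,
    Complex.exp_zero, one_mul]

end Literature.Analysis.SpecialFunctions

end
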